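import Literature.NumberTheory.Sieve.BombieriFriedlanderIwaniecPartition
import Literature.NumberTheory.Sieve.BombieriFriedlanderIwaniecPieces
import HarnessLib

/-!
# Bombieri–Friedlander–Iwaniec 1986, §§15, 17: tools for the interior pieces

Topic `Literature/NumberTheory/Sieve`, companion to
`Literature.NumberTheory.Sieve.BombieriFriedlanderIwaniecPartition` (the boxed, sieved factors
`factorMain` of a Heath-Brown piece and their products `prodMain κ`) and `…Pieces` (the absolute
Siegel–Walfisz property `SWAbs` of the sieved box indicator and of the sieved, boxed Möbius
function).  Everything here is PROVED.  It prepares the dispatch of an interior box-tuple to the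
cases of §17:

* `Literature.NumberTheory.Sieve.BFI.prod_pieces_support` — supports of Dirichlet products of pieces
  living in boxes `(P_i, (1+Δ)P_i]` multiply into `(∏ P_i, (1+Δ)^{#S} ∏ P_i]` (dyadic ranges);
* the shape of the factors: `factorMain_apply_zeta` (slots `i ≥ j`: `1_J · 1_{(·,P(z))=1}`),
  `factorMain_apply_moebius` (slots `i < j`: `μ 1_{≤U} 1_J 1_{(·,P(z))=1}`), `factorMain_eq_one`
  (a box below `1` carries the Dirichlet unit), and the identification with
  `roughBoxOne` / `roughBoxMoebius` of `…Pieces` (`factorMain_coe_eq_roughBoxOne`,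
  `factorMain_coe_eq_roughBoxMoebius`);
* `Literature.NumberTheory.Sieve.BFI.siegelWalfiszHyp_prod_pieces` — hypothesis (A₂) for a DENSE
  product of pieces (BFI p. 246: "(A₂) … is a consequence of the Siegel-Walfisz theorem"), through
  `siegelWalfiszHyp_of_dense` with the piece of the largest box as the distinguished factor;
* thresholds in `x` (`eventually_sw`) and `rpow_inv_thirteen_le_max`.

## References

* E. Bombieri, J. B. Friedlander, H. Iwaniec, *Primes in arithmetic progressions to large moduli*,
  Acta Math. 156 (1986), 203–251, §15 pp. 244–246, §17 p. 249. [BombieriFriedlanderIwaniecActa1986]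
-/

open Finset Real
open scoped ArithmeticFunction.sigma ArithmeticFunction.zeta ArithmeticFunction.Moebius

namespace Literature.NumberTheory.Sieve

namespace BFI

/-! ### Supports of products of pieces -/

/-- **Supports multiply.**  If every piece `f i` (`i ∈ G`) is supported in the box
`(P i, (1+Δ) P i]` on `z`-rough integers with `P i ≥ 1`, then for nonempty `S ⊆ G` the Dirichlet
product `∏_{i∈S} f i` is supported in `(∏_S P, (1+Δ)^{#S} ∏_S P]` on `z`-rough integers. [folklore] -/
theorem prod_pieces_support {ι : Type*} [DecidableEq ι] {G S : Finset ι} {f : ι → ArithmeticFunction ℝ}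
    {P : ι → ℝ} {Δ z : ℝ} (hSG : S ⊆ G) (hS : S.Nonempty) (hP : ∀ i ∈ G, 1 ≤ P i)
    (hsupp : ∀ i ∈ G, ∀ n : ℕ, f i n ≠ 0 → P i < n ∧ (n : ℝ) ≤ (1 + Δ) * P i ∧ IsRough z n) {n : ℕ}
    (hn : (∏ i ∈ S, f i) n ≠ 0) :
    (∏ i ∈ S, P i) < n ∧ (n : ℝ) ≤ (1 + Δ) ^ S.card * ∏ i ∈ S, P i ∧ IsRough z n := by
  have h1 := prod_apply_ne_zero_bounds hS (f := f) (a := P) (b := fun i => (1 + Δ) * P i)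
    (fun i hi => zero_le_one.trans (hP i (hSG hi)))
    (fun i hi d hd => ⟨(hsupp i (hSG hi) d hd).1, (hsupp i (hSG hi) d hd).2.1⟩) hn
  refine ⟨h1.1, h1.2.trans (le_of_eq ?_), isRough_of_prod_apply_ne_zero S
    (fun i hi d hd => (hsupp i (hSG hi) d hd).2.2) hn⟩
  rw [Finset.prod_mul_distrib, Finset.prod_const]

/-- The dyadic form: with `(1+Δ)^{#S} ≤ 2`, `∏_{i∈S} f i` is supported in `m ∼ ∏_S P` on `z`-rough
integers. [folklore] -/
theorem prod_pieces_support_dyadic {ι : Type*} [DecidableEq ι] {G S : Finset ι}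
    {f : ι → ArithmeticFunction ℝ} {P : ι → ℝ} {Δ z : ℝ} (hSG : S ⊆ G) (hS : S.Nonempty)
    (hP : ∀ i ∈ G, 1 ≤ P i)
    (hsupp : ∀ i ∈ G, ∀ n : ℕ, f i n ≠ 0 → P i < n ∧ (n : ℝ) ≤ (1 + Δ) * P i ∧ IsRough z n)
    (hΔ : (1 + Δ) ^ S.card ≤ 2) {n : ℕ} (hn : (∏ i ∈ S, f i) n ≠ 0) :
    n ∈ dyadic (∏ i ∈ S, P i) ∧ IsRough z n := by
  obtain ⟨h1, h2, h3⟩ := prod_pieces_support hSG hS hP hsupp hn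
  have hP0 : 0 ≤ ∏ i ∈ S, P i := Finset.prod_nonneg fun i hi => zero_le_one.trans (hP i (hSG hi))
  exact ⟨(mem_dyadic hP0).2 ⟨h1, h2.trans (mul_le_mul_of_nonneg_right hΔ hP0)⟩, h3⟩

/-- `1 ≤ ∏_{i∈S} P i` when every `P i ≥ 1`. [folklore] -/
theorem one_le_prod_pieces {ι : Type*} {G S : Finset ι} {P : ι → ℝ} (hSG : S ⊆ G)
    (hP : ∀ i ∈ G, 1 ≤ P i) : 1 ≤ ∏ i ∈ S, P i := by
  classical
  induction S using Finset.induction_on with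
  | empty => simp
  | @insert i s hi ih =>
    rw [Finset.prod_insert hi]
    have h1 : 1 ≤ P i := hP i (hSG (Finset.mem_insert_self i s))
    have h2 : 1 ≤ ∏ j ∈ s, P j := ih (fun j hj => hSG (Finset.mem_insert_of_mem hj))
    nlinarith


/-! ### The shape of the main factors -/

section FactorShape

variable {x z Δ : ℝ} {U j : ℕ}

/-- For the slots `i ≥ j` the function inside `factorMain` is `ζ`. [folklore] -/
theorem factorMain_inner_eq_zeta {i : ℕ} (hji : j ≤ i) (hi : i < 2 * j) :
    (if i = 2 * j - 1 then (ζ : ArithmeticFunction ℝ) else hbFactor U j i) = ζ := by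
  split_ifs with h
  · rfl
  · unfold hbFactor
    rw [if_neg (by omega), if_pos (by omega)]

/-- **The `ζ`-slots**: for `j ≤ i < 2j` and `n ≠ 0`,
`factorMain i k (n) = 1_{(boxLow, boxHigh]}(n) · 1_{(n,P(z))=1}`. [folklore] -/
theorem factorMain_apply_zeta {i : ℕ} (hji : j ≤ i) (hi : i < 2 * j) (k : ℕ) {n : ℕ} (hn : n ≠ 0) :
    factorMain x z Δ U j i k n =
      if boxLow (2 * x) Δ k < n ∧ (n : ℝ) ≤ boxHigh (2 * x) Δ k then (if IsRough z n then 1 else 0) else 0 := by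
  unfold factorMain
  rw [factorMain_inner_eq_zeta hji hi, boxRestrict_apply, roughRestrict_apply,
    ArithmeticFunction.natCoe_apply, ArithmeticFunction.zeta_apply_ne hn, Nat.cast_one]
  unfold InBox
  by_cases h1 : boxLow (2 * x) Δ k < n ∧ (n : ℝ) ≤ boxHigh (2 * x) Δ k
  · rw [if_pos ⟨Nat.pos_of_ne_zero hn, h1⟩, if_pos h1]
  · rw [if_neg (fun h => h1 h.2), if_neg h1]

/-- **The Möbius slots**: for `i < j` and `n ≠ 0`,
`factorMain i k (n) = μ(n) 1_{n ≤ U} · 1_{(boxLow, boxHigh]}(n) · 1_{(n,P(z))=1}`. [folklore] -/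
theorem factorMain_apply_moebius {i : ℕ} (hij : i < j) (k : ℕ) {n : ℕ} (hn : n ≠ 0) :
    factorMain x z Δ U j i k n =
      if boxLow (2 * x) Δ k < n ∧ (n : ℝ) ≤ boxHigh (2 * x) Δ k then
        (if IsRough z n then (if n ≤ U then (μ n : ℝ) else 0) else 0) else 0 := by
  unfold factorMain hbFactor
  rw [if_neg (by omega), if_pos hij, boxRestrict_apply, roughRestrict_apply,
    ArithmeticFunction.intCoe_apply, moebiusTrunc_apply]
  unfold InBox
  by_cases h1 : boxLow (2 * x) Δ k < n ∧ (n : ℝ) ≤ boxHigh (2 * x) Δ k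
  · rw [if_pos ⟨Nat.pos_of_ne_zero hn, h1⟩, if_pos h1]
    split_ifs <;> simp
  · rw [if_neg (fun h => h1 h.2), if_neg h1]

/-- A nonzero Möbius factor has its box starting below `U`. [folklore] -/
theorem boxLow_lt_of_moebius_ne_zero {i : ℕ} (hij : i < j) {k : ℕ}
    (hne : factorMain x z Δ U j i k ≠ 0) : boxLow (2 * x) Δ k < U := by
  obtain ⟨n, hn⟩ : ∃ n, factorMain x z Δ U j i k n ≠ 0 := by
    by_contra h
    push Not at h
    exact hne (ArithmeticFunction.ext fun n => by rw [h n]; rfl)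
  have hn0 : n ≠ 0 := by rintro rfl; exact hn (by simp)
  rw [factorMain_apply_moebius hij k hn0] at hn
  by_cases h1 : boxLow (2 * x) Δ k < n ∧ (n : ℝ) ≤ boxHigh (2 * x) Δ k
  · rw [if_pos h1] at hn
    by_cases h2 : IsRough z n
    · rw [if_pos h2] at hn
      by_cases h3 : n ≤ U
      · exact h1.1.trans_le (by exact_mod_cast h3)
      · rw [if_neg h3] at hn; exact absurd rfl hn
    · rw [if_neg h2] at hn; exact absurd rfl hn
  · rw [if_neg h1] at hn; exact absurd rfl hn

/-- Every main factor is bounded by `1` and supported in its box on `z`-rough integers; the box is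
`(boxLow, (1+Δ) boxLow]`. [folklore] -/
theorem factorMain_support (hΔ : -1 < Δ) {i : ℕ} (k : ℕ) {n : ℕ}
    (hn : factorMain x z Δ U j i k n ≠ 0) :
    boxLow (2 * x) Δ k < n ∧ (n : ℝ) ≤ (1 + Δ) * boxLow (2 * x) Δ k ∧ IsRough z n := by
  obtain ⟨⟨_, h1, h2⟩, h3⟩ := factorMain_ne_zero hn
  exact ⟨h1, by rwa [boxHigh_eq_mul_boxLow hΔ] at h2, h3⟩

/-- **Boxes below `1` carry the unit.**  If `boxLow < 1`, `0 ≤ Δ < 1`, `1 ≤ U` and the factor is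
not identically zero, then it is the Dirichlet unit `δ₁` (the box contains only the integer `1`,
where `ζ`, `μ_{≤U}` and the sieve indicator all equal `1`). [folklore] -/
theorem factorMain_eq_one {i : ℕ} (hi : i < 2 * j) (hU : 1 ≤ U) (hΔ0 : 0 ≤ Δ) (hΔ1 : Δ < 1)
    {k : ℕ} (hlow : boxLow (2 * x) Δ k < 1) (hne : factorMain x z Δ U j i k ≠ 0) :
    factorMain x z Δ U j i k = 1 := by
  have hΔ' : -1 < Δ := by linarith
  obtain ⟨m, hm⟩ : ∃ m, factorMain x z Δ U j i k m ≠ 0 := by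
    by_contra h
    push Not at h
    exact hne (ArithmeticFunction.ext fun n => by rw [h n]; rfl)
  obtain ⟨hm1, hm2, -⟩ := factorMain_support hΔ' k hm
  have hm0 : m ≠ 0 := by rintro rfl; exact hm (by simp)
  -- `m = 1`
  have hm_one : m = 1 := by
    have : (m : ℝ) < 2 := by nlinarith
    have : m < 2 := by exact_mod_cast this
    omega
  subst hm_one
  have hhigh : ((1 : ℕ) : ℝ) ≤ boxHigh (2 * x) Δ k := by
    rw [boxHigh_eq_mul_boxLow hΔ']; exact_mod_cast hm2
  ext n
  rcases Nat.lt_trichotomy n 1 with h | rfl | h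
  · have : n = 0 := by omega
    subst this; simp
  · -- value at `1`
    rw [ArithmeticFunction.one_one]
    have hr : IsRough z 1 := fun p hp => by simp at hp
    rcases lt_or_ge i j with hij | hji
    · rw [factorMain_apply_moebius hij k one_ne_zero, if_pos ⟨by exact_mod_cast hm1, hhigh⟩, if_pos hr,
        if_pos hU]
      simp
    · rw [factorMain_apply_zeta hji hi k one_ne_zero, if_pos ⟨by exact_mod_cast hm1, hhigh⟩, if_pos hr]
  · rw [ArithmeticFunction.one_apply_ne (by omega)]
    by_contra hn
    obtain ⟨-, hn2, -⟩ := factorMain_support hΔ' k hn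
    have : (2 : ℝ) ≤ n := by exact_mod_cast h
    nlinarith

/-- A `ζ`-slot factor with `boxLow ≥ 0`, as a function, is the sieved box indicator
`roughBoxOne z ⌊boxLow⌋ ⌊boxHigh⌋`. [folklore] -/
theorem factorMain_coe_eq_roughBoxOne {i : ℕ} (hji : j ≤ i) (hi : i < 2 * j) (hx : 0 < x) (hΔ : -1 < Δ)
    (k : ℕ) :
    (⇑(factorMain x z Δ U j i k) : ℕ → ℝ) =
      roughBoxOne z ⌊boxLow (2 * x) Δ k⌋₊ ⌊boxHigh (2 * x) Δ k⌋₊ := by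
  have hlow : 0 ≤ boxLow (2 * x) Δ k := (boxLow_pos (by linarith) hΔ k).le
  have hhigh : 0 ≤ boxHigh (2 * x) Δ k := by
    rw [boxHigh_eq_mul_boxLow hΔ]; exact mul_nonneg (by linarith) hlow
  funext n
  rcases Nat.eq_zero_or_pos n with rfl | hn
  · simp [roughBoxOne]
  · rw [factorMain_apply_zeta hji hi k hn.ne', roughBoxOne]
    have e1 : (⌊boxLow (2 * x) Δ k⌋₊ < n) = (boxLow (2 * x) Δ k < n) := propext (Nat.floor_lt hlow)
    have e2 : (n ≤ ⌊boxHigh (2 * x) Δ k⌋₊) = ((n : ℝ) ≤ boxHigh (2 * x) Δ k) := propext (Nat.le_floor_iff hhigh)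
    have e3 : IsRough z n = n.Coprime (primesProdBelow z) := propext (isRough_iff_coprime_primesProdBelow hn.ne')
    simp only [e1, e2, ← e3]
    by_cases h1 : boxLow (2 * x) Δ k < n <;> by_cases h2 : (n : ℝ) ≤ boxHigh (2 * x) Δ k <;>
      by_cases h3 : IsRough z n <;> simp [h1, h2, h3]

/-- A Möbius-slot factor with `boxLow ≥ 0`, as a function, is the sieved, boxed Möbius function
`roughBoxMoebius z ⌊boxLow⌋ (min ⌊boxHigh⌋ U)`. [folklore] -/
theorem factorMain_coe_eq_roughBoxMoebius {i : ℕ} (hij : i < j) (hx : 0 < x) (hΔ : -1 < Δ) (k : ℕ) :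
    (⇑(factorMain x z Δ U j i k) : ℕ → ℝ) =
      roughBoxMoebius z ⌊boxLow (2 * x) Δ k⌋₊ (min ⌊boxHigh (2 * x) Δ k⌋₊ U) := by
  have hlow : 0 ≤ boxLow (2 * x) Δ k := (boxLow_pos (by linarith) hΔ k).le
  have hhigh : 0 ≤ boxHigh (2 * x) Δ k := by
    rw [boxHigh_eq_mul_boxLow hΔ]; exact mul_nonneg (by linarith) hlow
  funext n
  rcases Nat.eq_zero_or_pos n with rfl | hn
  · simp [roughBoxMoebius]
  · rw [factorMain_apply_moebius hij k hn.ne', roughBoxMoebius]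
    have e1 : (⌊boxLow (2 * x) Δ k⌋₊ < n) = (boxLow (2 * x) Δ k < n) := propext (Nat.floor_lt hlow)
    have e2 : (n ≤ min ⌊boxHigh (2 * x) Δ k⌋₊ U) = (((n : ℝ) ≤ boxHigh (2 * x) Δ k) ∧ n ≤ U) := by
      rw [le_min_iff, Nat.le_floor_iff hhigh]
    have e3 : IsRough z n = n.Coprime (primesProdBelow z) := propext (isRough_iff_coprime_primesProdBelow hn.ne')
    simp only [e1, e2, ← e3]
    by_cases h1 : boxLow (2 * x) Δ k < n <;> by_cases h2 : (n : ℝ) ≤ boxHigh (2 * x) Δ k <;>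
      by_cases h3 : IsRough z n <;> by_cases h4 : n ≤ U <;> simp [h1, h2, h3, h4]

end FactorShape


/-! ### Hypothesis (A₂) for a dense product of pieces -/

/-- `e^{16} ≥ 2^{16}`. [folklore] -/
theorem two_pow_sixteen_le_exp : (2 : ℝ) ^ 16 ≤ Real.exp 16 := by
  have h := Real.exp_one_gt_d9
  have : (2 : ℝ) ^ 16 ≤ (Real.exp 1) ^ 16 := pow_le_pow_left₀ (by norm_num) (by linarith) 16
  rw [← Real.exp_nat_mul] at this
  norm_num at this ⊢
  exact this

/-- **Dense products of pieces satisfy (A₂)** (BFI §15 p. 246: "(A₂) … is a consequence of the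
Siegel–Walfisz theorem", via `siegelWalfiszHyp_of_dense`).  The distinguished factor `h = f i₀` is
the piece with the LARGEST box in `S` (so that `N ≤ P(i₀)^{13}` and `log 2N ≤ 14 log ⌊P(i₀)⌋`), it is a
sieved box indicator `1_J 1_{(·,P(z))=1}` or a sieved, boxed Möbius function `μ 1_J 1_{(·,P(z))=1}`,
for which the absolute Siegel–Walfisz property `SWAbs` holds with constants `Ch` (from the
fundamental lemma, resp. Siegel–Walfisz for `μ`), and `g = ∏_{S ∖ {i₀}} f` is the divisor-bounded
cofactor. [cite: BombieriFriedlanderIwaniecActa1986, §15 p. 246] -/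
theorem siegelWalfiszHyp_prod_pieces {ι : Type*} [DecidableEq ι] {Ch : ℝ → ℝ → ℝ}
    (hCh1 : ∀ A₁ A₂ : ℝ, 0 < A₁ → 0 < A₂ → ∀ (z Nh : ℝ) (Y₁ Y₂ : ℕ), 2 ≤ z → z ≤ Real.sqrt Nh →
      Real.log z ≤ 12 * Real.sqrt (Real.log Nh) → 3 ≤ Nh → Nh ≤ Y₁ → (Y₂ : ℝ) ≤ 2 * Nh →
      SWAbs (roughBoxOne z Y₁ Y₂) Nh A₁ A₂ (Ch A₁ A₂))
    (hCh2 : ∀ A₁ A₂ : ℝ, 0 < A₁ → 0 < A₂ → ∀ (z Nh : ℝ) (Y₁ Y₂ : ℕ), 8 ≤ z →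
      Real.log z ≤ 12 * Real.sqrt (Real.log Nh) → Real.exp 16 ≤ Nh → Nh ≤ Y₁ → Y₁ ≤ Y₂ →
      (Y₂ : ℝ) ≤ 2 * Nh → SWAbs (roughBoxMoebius z Y₁ Y₂) Nh A₁ A₂ (Ch A₁ A₂))
    {Csw : ℝ → ℝ} {cD : ℝ}
    (hCsw : ∀ (N Nh : ℝ) (g h : ArithmeticFunction ℝ), 1 ≤ N → 1 ≤ Nh → Nh ≤ 2 * N →
      Real.log (2 * N) ≤ 14 * Real.log Nh →
      (∀ A₁ A₂ : ℝ, 0 < A₁ → 0 < A₂ → SWAbs (⇑h) Nh A₁ A₂ (Ch A₁ A₂)) →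
      (∀ v, |h v| ≤ 1) → (∀ v : ℕ, h v ≠ 0 → Nh < v ∧ (v : ℝ) ≤ 2 * Nh) →
      (∀ u, |g u| ≤ (σ 0 u : ℝ) ^ 12) → (∀ u v : ℕ, g u ≠ 0 → h v ≠ 0 → u * v ∈ dyadic N) →
      N ≤ Real.log (2 * N) ^ cD * l2Sq N ⇑(g * h) → SiegelWalfiszHyp N 2 Csw ⇑(g * h))
    {G S : Finset ι} {f : ι → ArithmeticFunction ℝ} {P : ι → ℝ} {z Δ : ℝ} {U : ℕ}
    (hP : ∀ i ∈ G, 1 ≤ P i) (hf1 : ∀ i ∈ G, ∀ n, |f i n| ≤ 1)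
    (hsupp : ∀ i ∈ G, ∀ n : ℕ, f i n ≠ 0 → P i < n ∧ (n : ℝ) ≤ (1 + Δ) * P i ∧ IsRough z n)
    (htype : ∀ i ∈ G, (⇑(f i) = roughBoxOne z ⌊P i⌋₊ ⌊(1 + Δ) * P i⌋₊) ∨
      (P i < U ∧ ⇑(f i) = roughBoxMoebius z ⌊P i⌋₊ (min ⌊(1 + Δ) * P i⌋₊ U)))
    (hSG : S ⊆ G) (hcard : S.card ≤ 13) (hΔ0 : 0 ≤ Δ) (hΔ2 : Δ ≤ 1 / 2) (hΔ13 : (1 + Δ) ^ 13 ≤ 2)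
    {i₀ : ι} (hi₀ : i₀ ∈ S) (hmax : ∀ i ∈ S, P i ≤ P i₀)
    (hbig : Real.exp 16 + 1 ≤ P i₀) (hz8 : 8 ≤ z) (hzP : z ^ 2 ≤ P i₀ / 2)
    (hlogz : Real.log z ≤ 12 * Real.sqrt (Real.log (P i₀ / 2)))
    (hdense : (∏ i ∈ S, P i) ≤ Real.log (2 * ∏ i ∈ S, P i) ^ cD * l2Sq (∏ i ∈ S, P i) ⇑(∏ i ∈ S, f i)) :
    SiegelWalfiszHyp (∏ i ∈ S, P i) 2 Csw ⇑(∏ i ∈ S, f i) := by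
  -- notation
  set Pst : ℝ := P i₀ with hPst
  set N : ℝ := ∏ i ∈ S, P i with hN
  set Nh : ℝ := (⌊Pst⌋₊ : ℝ) with hNh
  set h : ArithmeticFunction ℝ := f i₀ with hh
  set g : ArithmeticFunction ℝ := ∏ i ∈ S.erase i₀, f i with hg
  have hgh : g * h = ∏ i ∈ S, f i := Finset.prod_erase_mul S f hi₀
  have hi₀G : i₀ ∈ G := hSG hi₀
  -- sizes
  have he16 : (2 : ℝ) ^ 16 ≤ Real.exp 16 := two_pow_sixteen_le_exp
  have hP33 : (2 : ℝ) ^ 16 + 1 ≤ Pst := le_trans (by linarith) hbig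
  have hP4 : (4 : ℝ) ≤ Pst := le_trans (by norm_num) hP33
  have hP0 : 0 < Pst := by linarith
  have hNhle : Nh ≤ Pst := Nat.floor_le hP0.le
  have hNhge : Pst - 1 < Nh := by rw [hNh]; exact Nat.lt_floor_add_one Pst |> fun h => by linarith
  have hNh16 : Real.exp 16 ≤ Nh := by linarith
  have hNh3 : (3 : ℝ) ≤ Nh := by linarith
  have hNh1 : (1 : ℝ) ≤ Nh := by linarith
  have hNh0 : 0 < Nh := by linarith
  have hNhhalf : Pst / 2 ≤ Nh := by linarith
  have hPi1 : ∀ i ∈ S, 1 ≤ P i := fun i hi => hP i (hSG hi)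
  have hNP : Pst ≤ N := by
    rw [hN, ← Finset.mul_prod_erase S P hi₀]
    have h1 : 1 ≤ ∏ i ∈ S.erase i₀, P i := one_le_prod_pieces ((Finset.erase_subset _ _).trans hSG) hP
    have : Pst * 1 ≤ P i₀ * ∏ i ∈ S.erase i₀, P i := mul_le_mul_of_nonneg_left h1 hP0.le
    linarith
  have hN1 : 1 ≤ N := le_trans (by linarith) hNP
  have hN0 : 0 < N := by linarith
  have hN13 : N ≤ Pst ^ 13 := by
    calc N ≤ ∏ i ∈ S, Pst := Finset.prod_le_prod (fun i hi => zero_le_one.trans (hPi1 i hi)) hmax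
      _ = Pst ^ S.card := Finset.prod_const Pst
      _ ≤ Pst ^ 13 := pow_le_pow_right₀ (by linarith) hcard
  have hNh2N : Nh ≤ 2 * N := by linarith
  -- `log 2N ≤ 14 log Nh`
  have hlog2 : (0.6931471803 : ℝ) < Real.log 2 := Real.log_two_gt_d9
  have hlogPst : 16 * Real.log 2 ≤ Real.log Pst := by
    have h1 : Real.log ((2 : ℝ) ^ 16) ≤ Real.log Pst := Real.log_le_log (by positivity) (by linarith)
    rwa [Real.log_pow, Nat.cast_ofNat] at h1
  have hlogNh : Real.log Pst - Real.log 2 ≤ Real.log Nh := by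
    have h1 : Real.log (Pst / 2) ≤ Real.log Nh := Real.log_le_log (by positivity) hNhhalf
    rwa [Real.log_div hP0.ne' (by norm_num)] at h1
  have hlog2N : Real.log (2 * N) ≤ 14 * Real.log Nh := by
    have h1 : Real.log (2 * N) ≤ Real.log 2 + 13 * Real.log Pst := by
      rw [Real.log_mul (by norm_num) hN0.ne']
      have h2 : Real.log N ≤ Real.log (Pst ^ 13) := Real.log_le_log hN0 hN13
      rw [Real.log_pow] at h2
      push_cast at h2
      linarith only [h2]
    linarith only [h1, hlogNh, hlogPst, hlog2]
  -- the distinguished factor `h`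
  have hbox2 : (1 + Δ) * Pst ≤ 2 * (Pst - 1) := by nlinarith only [hΔ2, hΔ0, hP4, hP0]
  have h2Nh : 2 * (Pst - 1) ≤ 2 * Nh := by linarith only [hNhge]
  have hY2 : ((⌊(1 + Δ) * Pst⌋₊ : ℕ) : ℝ) ≤ 2 * Nh := by
    calc ((⌊(1 + Δ) * Pst⌋₊ : ℕ) : ℝ) ≤ (1 + Δ) * Pst :=
          Nat.floor_le (mul_nonneg (by linarith only [hΔ0]) hP0.le)
      _ ≤ 2 * (Pst - 1) := hbox2
      _ ≤ 2 * Nh := h2Nh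
  have hzsqrt : z ≤ Real.sqrt Nh := by
    rw [Real.le_sqrt (by linarith only [hz8]) hNh0.le]; linarith only [hzP, hNhhalf]
  have hlogz' : Real.log z ≤ 12 * Real.sqrt (Real.log Nh) := by
    refine hlogz.trans (mul_le_mul_of_nonneg_left (Real.sqrt_le_sqrt ?_) (by norm_num))
    exact Real.log_le_log (by positivity) hNhhalf
  have hswabs : ∀ A₁ A₂ : ℝ, 0 < A₁ → 0 < A₂ → SWAbs (⇑h) Nh A₁ A₂ (Ch A₁ A₂) := by
    intro A₁ A₂ hA₁ hA₂
    rcases htype i₀ hi₀G with h1 | ⟨hU, h1⟩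
    · rw [hh, h1]
      exact hCh1 A₁ A₂ hA₁ hA₂ z Nh _ _ (by linarith) hzsqrt hlogz' hNh3 (by rw [hNh]) hY2
    · rw [hh, h1]
      refine hCh2 A₁ A₂ hA₁ hA₂ z Nh _ _ hz8 hlogz' hNh16 (by rw [hNh]) ?_ ?_
      · refine le_min (Nat.floor_le_floor (by nlinarith only [hΔ0, hP0])) ?_
        have := Nat.floor_le_floor hU.le
        rwa [Nat.floor_natCast] at this
      · have hmin : ((min ⌊(1 + Δ) * Pst⌋₊ U : ℕ) : ℝ) ≤ ((⌊(1 + Δ) * Pst⌋₊ : ℕ) : ℝ) := by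
          exact_mod_cast min_le_left _ _
        exact hmin.trans hY2
  have hh1 : ∀ v, |h v| ≤ 1 := hf1 i₀ hi₀G
  have hhsupp : ∀ v : ℕ, h v ≠ 0 → Nh < v ∧ (v : ℝ) ≤ 2 * Nh := by
    intro v hv
    obtain ⟨h1, h2, -⟩ := hsupp i₀ hi₀G v hv
    exact ⟨hNhle.trans_lt h1, h2.trans (hbox2.trans h2Nh)⟩
  -- the cofactor `g`
  have hg12 : ∀ u, |g u| ≤ (σ 0 u : ℝ) ^ 12 := by
    intro u
    have h1 := abs_prod_apply_le_sigma_zero_pow (S.erase i₀) f (fun i hi n => hf1 i (hSG (Finset.mem_of_mem_erase hi)) n) u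
    rw [← hg] at h1
    rcases Nat.eq_zero_or_pos u with rfl | hu
    · simp [hg]
    · refine h1.trans (pow_le_pow_right₀ ?_ ?_)
      · exact_mod_cast one_le_sigma_zero hu.ne'
      · have := Finset.card_erase_of_mem hi₀; omega
  have hguv : ∀ u v : ℕ, g u ≠ 0 → h v ≠ 0 → u * v ∈ dyadic N := by
    intro u v hu hv
    obtain ⟨hv1, hv2, -⟩ := hsupp i₀ hi₀G v hv
    have hNsplit : N = (∏ i ∈ S.erase i₀, P i) * Pst := by rw [hN, Finset.prod_erase_mul S P hi₀]
    rcases (S.erase i₀).eq_empty_or_nonempty with he | hne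
    · -- `g = 1`, `u = 1`
      have hu1 : u = 1 := by
        by_contra hne1
        apply hu
        rw [hg, he, Finset.prod_empty, ArithmeticFunction.one_apply_ne hne1]
      rw [hNsplit, he, Finset.prod_empty, one_mul, hu1, one_mul, mem_dyadic hP0.le]
      refine ⟨hv1, hv2.trans ?_⟩
      exact mul_le_mul_of_nonneg_right (by linarith only [hΔ2]) hP0.le
    · rw [hg] at hu
      obtain ⟨hu1, hu2, -⟩ := prod_pieces_support ((Finset.erase_subset _ _).trans hSG) hne hP hsupp hu
      set Q : ℝ := ∏ i ∈ S.erase i₀, P i with hQ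
      have hQ1 : 1 ≤ Q := one_le_prod_pieces ((Finset.erase_subset _ _).trans hSG) hP
      have hcard' : (S.erase i₀).card + 1 ≤ 13 := by
        have := Finset.card_erase_of_mem hi₀; omega
      have hpow : (1 + Δ) ^ (S.erase i₀).card * (1 + Δ) ≤ 2 :=
        le_trans (by rw [← pow_succ]; exact pow_le_pow_right₀ (by linarith) hcard') hΔ13
      have hQP0 : 0 ≤ Q * Pst := mul_nonneg (zero_le_one.trans hQ1) hP0.le
      have h1Δ : 0 ≤ 1 + Δ := by linarith only [hΔ0]
      rw [hNsplit, mem_dyadic hQP0]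
      push_cast
      constructor
      · calc Q * Pst < (u : ℝ) * Pst := mul_lt_mul_of_pos_right hu1 hP0
          _ ≤ (u : ℝ) * v := by
              refine mul_le_mul_of_nonneg_left hv1.le (Nat.cast_nonneg _)
      · calc (u : ℝ) * v ≤ ((1 + Δ) ^ (S.erase i₀).card * Q) * ((1 + Δ) * Pst) :=
            mul_le_mul hu2 hv2 (Nat.cast_nonneg _) (mul_nonneg (pow_nonneg h1Δ _) (zero_le_one.trans hQ1))
          _ = ((1 + Δ) ^ (S.erase i₀).card * (1 + Δ)) * (Q * Pst) := by ring
          _ ≤ 2 * (Q * Pst) := mul_le_mul_of_nonneg_right hpow hQP0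
  -- density and conclusion
  have hdense' : N ≤ Real.log (2 * N) ^ cD * l2Sq N ⇑(g * h) := by rw [hgh]; exact hdense
  have := hCsw N Nh g h hN1 hNh1 hNh2N hlog2N hswabs hh1 hhsupp hg12 hguv hdense'
  rwa [hgh] at this


/-! ### Thresholds in `x` for the Siegel–Walfisz construction -/

/-- For `x ≥ x₀` and every exponent `c ∈ [1/100, 1]`: `e^{16} + 1 ≤ x^c`,
`exp(2√log x) ≤ x^c/2` and `√(log x) ≤ 12 √(log (x^c/2))` (the size, and the two conditions on the
sifting level `z = exp(√log x)`, of the distinguished piece in `siegelWalfiszHyp_prod_pieces`).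
[folklore] -/
theorem eventually_sw :
    ∃ x₀ : ℝ, ∀ x : ℝ, x₀ ≤ x → ∀ c : ℝ, 1 / 100 ≤ c → c ≤ 1 →
      Real.exp 16 + 1 ≤ x ^ c ∧
      Real.exp (Real.sqrt (Real.log x)) ^ 2 ≤ x ^ c / 2 ∧
      Real.sqrt (Real.log x) ≤ 12 * Real.sqrt (Real.log (x ^ c / 2)) := by
  refine ⟨max ((Real.exp 16 + 1) ^ (100 : ℕ)) (Real.exp 40401), fun x hx c hc1 hc2 => ?_⟩
  have hxA : (Real.exp 16 + 1) ^ (100 : ℕ) ≤ x := le_trans (le_max_left _ _) hx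
  have hxB : Real.exp 40401 ≤ x := le_trans (le_max_right _ _) hx
  have he16 : 0 < Real.exp 16 := Real.exp_pos 16
  have hx1 : (1 : ℝ) ≤ x := le_trans (one_le_pow₀ (by linarith)) hxA
  have hx0 : 0 < x := by linarith
  set L : ℝ := Real.log x with hLdef
  have hL : 40401 ≤ L := by rw [hLdef, Real.le_log_iff_exp_le hx0]; exact hxB
  have hL0 : 0 < L := by linarith
  have hsq : Real.sqrt L * Real.sqrt L = L := Real.mul_self_sqrt hL0.le
  have hs201 : 201 ≤ Real.sqrt L := by
    rw [show (201 : ℝ) = Real.sqrt (201 ^ 2) by rw [Real.sqrt_sq (by norm_num)]]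
    exact Real.sqrt_le_sqrt (by nlinarith)
  have hlog2 : Real.log 2 < 1 := by
    have := Real.log_two_lt_d9; linarith
  have hlog2' : 0 < Real.log 2 := Real.log_pos (by norm_num)
  refine ⟨?_, ?_, ?_⟩
  · -- `x^c ≥ x^{1/100} ≥ e^16 + 1`
    calc Real.exp 16 + 1 = ((Real.exp 16 + 1) ^ (100 : ℕ)) ^ (1 / 100 : ℝ) := by
          rw [← Real.rpow_natCast, ← Real.rpow_mul (by linarith)]; norm_num
      _ ≤ x ^ (1 / 100 : ℝ) := Real.rpow_le_rpow (by positivity) hxA (by norm_num)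
      _ ≤ x ^ c := Real.rpow_le_rpow_of_exponent_le hx1 hc1
  · -- `2√L + log 2 ≤ cL`
    rw [← Real.exp_nat_mul, Real.rpow_def_of_pos hx0, ← hLdef, le_div_iff₀ (by norm_num : (0:ℝ) < 2)]
    have h2 : (2 : ℝ) = Real.exp (Real.log 2) := (Real.exp_log (by norm_num)).symm
    rw [mul_comm, h2, ← Real.exp_add, Real.exp_le_exp]
    push_cast
    have : L / 100 ≤ L * c := by nlinarith
    nlinarith
  · -- `L ≤ 144 (cL - log 2)`
    have hxc : 0 < x ^ c / 2 := by positivity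
    have hlogxc : Real.log (x ^ c / 2) = c * L - Real.log 2 := by
      rw [Real.log_div (by positivity) (by norm_num), Real.log_rpow hx0, hLdef]
    have hpos : 0 ≤ c * L - Real.log 2 := by nlinarith
    rw [hlogxc, show (12 : ℝ) * Real.sqrt (c * L - Real.log 2) = Real.sqrt (144 * (c * L - Real.log 2)) by
      rw [Real.sqrt_mul (by norm_num), show (144 : ℝ) = 12 ^ 2 by norm_num, Real.sqrt_sq (by norm_num)]]
    exact Real.sqrt_le_sqrt (by nlinarith)

/-- The largest box of a partial product dominates: if `N = ∏_{i∈S} P i` with `1 ≤ P i ≤ P i₀`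
(`i₀ ∈ S`, `#S ≤ 13`) then `N ≤ P(i₀)^{13}`, so `N^{1/13} ≤ P i₀`. [folklore] -/
theorem rpow_inv_thirteen_le_max {ι : Type*} {S : Finset ι} {P : ι → ℝ} (hP : ∀ i ∈ S, 1 ≤ P i)
    (hcard : S.card ≤ 13) {i₀ : ι} (hi₀ : i₀ ∈ S) (hmax : ∀ i ∈ S, P i ≤ P i₀) :
    (∏ i ∈ S, P i) ^ (1 / 13 : ℝ) ≤ P i₀ := by
  have hP1 : 1 ≤ P i₀ := hP i₀ hi₀
  have hN : ∏ i ∈ S, P i ≤ P i₀ ^ (13 : ℕ) := by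
    calc ∏ i ∈ S, P i ≤ ∏ i ∈ S, P i₀ := Finset.prod_le_prod (fun i hi => zero_le_one.trans (hP i hi)) hmax
      _ = P i₀ ^ S.card := Finset.prod_const _
      _ ≤ P i₀ ^ 13 := pow_le_pow_right₀ hP1 hcard
  have h0 : 0 ≤ ∏ i ∈ S, P i := Finset.prod_nonneg fun i hi => zero_le_one.trans (hP i hi)
  calc (∏ i ∈ S, P i) ^ (1 / 13 : ℝ) ≤ (P i₀ ^ (13 : ℕ)) ^ (1 / 13 : ℝ) := Real.rpow_le_rpow h0 hN (by norm_num)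
    _ = P i₀ := by rw [← Real.rpow_natCast, ← Real.rpow_mul (by linarith)]; norm_num

end BFI

end Literature.NumberTheory.Sieve
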